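import Summits.MatrixMultiplication.OmegaCensus.DominoZ13StructSevenData
import Summits.MatrixMultiplication.OmegaCensus.DominoZpZpStructSevenCheck
import HarnessLib

/-!
# The pair checks of family `A` for the structural part-`7` route, `p = 13` (part 6 of 16: group 2, blocks 8–14)

ω-census `pub-omega`, family (b3), seat pub-omega-group gen 24.  Framing: lottery ticket; floor = certified bounds/negative
ranges.  VALUE: per-prime kernel data of the STRUCTURAL part-`7` route (`DominoZpZpStructSeven*.lean`) for `p = 13` —
target: the OPEN census cell `(1,7,8)@169` (`A = ℤ₁₃²`) and every larger order with a quotient `ℤ₁₃²`; NOT progress on ω.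

BATCHED kernel decides `checkH7axs 13 etZ13s7 ((rZ13s7.drop 4c).take 4) xsaZ13s7_g2` (`DominoZpZpStructSevenCheck.lean`): the
`y`-arrangements of the 4 representatives of block `c` are generated once in the kernel and tested against every `x`-arrangement
of the group (≈ 7.4 ms per configuration measured on the farm; 23520 configurations in this file; one decide ≲ 35 s keeps the
kernel under its memory ceiling).  Per-arrangement / per-representative theorems: `DominoZ13StructSevenPairsAX*.lean`.
Exact pre-check (`code/gen_struct7c.py`, same programs in Python): all 233860 configurations of family `A`
have ≥ 8 good pairs of the 21.  Independent of the other parts.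
-/

namespace Summit.MatrixMultiplication.OmegaCensus

open ZpZpDomino

namespace ZpZpDomino

set_option maxHeartbeats 4000000 in
/-- Batched pair check, family `A`, group 2, `y`-source block 8 (7 × 480 configurations). [folklore] -/
theorem checkH7axs_13_g2_c8 : checkH7axs 13 etZ13s7 ((rZ13s7.drop 28).take 4) xsaZ13s7_g2 = true := by
  decide +kernel

set_option maxHeartbeats 4000000 in
/-- Batched pair check, family `A`, group 2, `y`-source block 9 (7 × 480 configurations). [folklore] -/
theorem checkH7axs_13_g2_c9 : checkH7axs 13 etZ13s7 ((rZ13s7.drop 32).take 4) xsaZ13s7_g2 = true := by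
  decide +kernel

set_option maxHeartbeats 4000000 in
/-- Batched pair check, family `A`, group 2, `y`-source block 10 (7 × 480 configurations). [folklore] -/
theorem checkH7axs_13_g2_c10 : checkH7axs 13 etZ13s7 ((rZ13s7.drop 36).take 4) xsaZ13s7_g2 = true := by
  decide +kernel

set_option maxHeartbeats 4000000 in
/-- Batched pair check, family `A`, group 2, `y`-source block 11 (7 × 480 configurations). [folklore] -/
theorem checkH7axs_13_g2_c11 : checkH7axs 13 etZ13s7 ((rZ13s7.drop 40).take 4) xsaZ13s7_g2 = true := by
  decide +kernel

set_option maxHeartbeats 4000000 in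
/-- Batched pair check, family `A`, group 2, `y`-source block 12 (7 × 480 configurations). [folklore] -/
theorem checkH7axs_13_g2_c12 : checkH7axs 13 etZ13s7 ((rZ13s7.drop 44).take 4) xsaZ13s7_g2 = true := by
  decide +kernel

set_option maxHeartbeats 4000000 in
/-- Batched pair check, family `A`, group 2, `y`-source block 13 (7 × 480 configurations). [folklore] -/
theorem checkH7axs_13_g2_c13 : checkH7axs 13 etZ13s7 ((rZ13s7.drop 48).take 4) xsaZ13s7_g2 = true := by
  decide +kernel

set_option maxHeartbeats 4000000 in
/-- Batched pair check, family `A`, group 2, `y`-source block 14 (7 × 480 configurations). [folklore] -/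
theorem checkH7axs_13_g2_c14 : checkH7axs 13 etZ13s7 ((rZ13s7.drop 52).take 4) xsaZ13s7_g2 = true := by
  decide +kernel

end ZpZpDomino

end Summit.MatrixMultiplication.OmegaCensus
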